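import Literature.AlgebraicGeometry.ShimuraVarieties.UnitaryBallAutomorphicForms
import Literature.AlgebraicGeometry.HodgeTheory.RationalHodgeClasses
import Literature.NumberTheory.Transcendental.ComplexLinearFormsPointwise
import Literature.NumberTheory.Transcendental.ComplexFormsPullback
import Literature.NumberTheory.Transcendental.AnalytificationHolomorphyTest
import HarnessLib

/-!
# Pull-back of forms along the uniformization of a unitary ball quotient

The DATA direction of the Hodge dictionary for a compact ball quotient `X(ℂ) = Γ\𝔹²`
(`UnitaryBallUniformisationDatum 2 X`), read in a Hodge model `A : HodgeModel 2 X` of `X`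
(`HodgeTheory.RationalHodgeClasses`: the complex manifold `X^an` with its de Rham comparison):

* `D.modelUnif A 𝔣 : ℂ² → A.carrier`, the uniformization `w ↦ (X^an ≃ X(ℂ))⁻¹ (unif (T (w, 1)))`
  in a Sylvester frame `𝔣` (total on `ℂ²`; meaningful on the open ball `BallForms.ballSet`): it is
  `Γ`-invariant (`modelUnif_smul`), continuous on the ball, onto `X^an`, with fibres the
  `Γ`-orbits (`modelUnif_eq_iff`);
* `unifHolomorphic`: the uniformization is HOLOMORPHIC on the ball as a map into `X^an` (proved:
  regular functions pull back to holomorphic functions on the cone, `differentiableOn_unif`, and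
  holomorphy into an analytification is tested on regular functions,
  `IsAnalytification.mdifferentiableAt_of_comp_regular` — Serre, GAGA §2 n°6);
* the **pull-back of complex `k`-forms** on `X^an` to functions on `𝔹²`:
  `D.formPullback₁ A 𝔣 : MForm 𝓘(ℝ, A.model) A.carrier ℂ 1 →ₗ[ℂ] (Ball → (Fin 2 → ℂ))`
  (`α ↦ (z ↦ (α(dψ e₀), α(dψ e₁)))`) and
  `D.formPullback₂ A 𝔣 : MForm 𝓘(ℝ, A.model) A.carrier ℂ 2 →ₗ[ℂ] (Ball → ℂ)`
  (`α ↦ (z ↦ α(dψ e₀, dψ e₁))`);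
* the **automorphy of pull-backs** (all proved): for a `ℂ`-linear `1`-form `α` (type `(1,0)`,
  `IsComplexLinearForm`, cf. `IsOfType.isComplexLinearForm`) and `γ ∈ Γ`,
  `F(z) = J(γ, z)ᵀ F(γ z)` (`formPullback₁_smul`), i.e. `F ∈ factorForms Γ cotangentCocycle`
  (`formPullback₁_mem_factorForms`); for a `ℂ`-bilinear `2`-form,
  `G(z) = det J(γ, z) · G(γ z)` (`formPullback₂_smul`, `formPullback₂_mem_factorForms`: the
  canonical factor). These are the chain rule for `ψ ∘ γ = ψ` plus `ℂ`-linearity of `dψ`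
  (`mfderiv_real_apply_smul`) and of `α`.

So holomorphic `1`-forms (resp. `2`-forms) on `X^an` ARE vector-valued automorphic forms on `𝔹²`
of cotangent (resp. canonical) type for `Γ` — the identification behind
`H^{p,0}(Γ\𝔹²) = {holomorphic automorphic forms of type Λᵖ(J⁻¹)ᵀ}`; the converse direction and
the statement that these exhaust `H^{p,0} ⊆ Hᵖ(X(ℂ); ℂ)` are Hodge theory, recorded elsewhere.

References: A. Borel, *Automorphic forms on SL₂(ℝ)* (1997), §5.14 (automorphy factors and
forms); C. Voisin, *Hodge Theory and Complex Algebraic Geometry I* (2002), §2.2.1 (holomorphic maps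
and their real differentials); N. Bergeron, J. Millson, C. Moeglin (2016), Introduction §1.1.
-/

noncomputable section

open Matrix MulAction Function
open scoped Manifold Topology
open Literature.Geometry.ComplexHyperbolic
open Literature.Geometry.ComplexHyperbolic.BallModel (U21 Ball Jac x₀ nsq actVec)
open Literature.Geometry.Kaehler (MForm)
open Literature.NumberTheory.Transcendental
open Literature.NumberTheory.Automorphic.AutomorphyFactor
open Literature.AlgebraicGeometry.HodgeTheory (HodgeModel)

namespace Literature.AlgebraicGeometry.ShimuraVarieties

namespace UnitaryBallUniformisationDatum

variable {X₂ : Motives.SchemeOver ℂ} (D : UnitaryBallUniformisationDatum 2 X₂) (A : HodgeModel 2 X₂)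
  (𝔣 : D.SylvesterFrame)

/-! ### The uniformization read in a Hodge model -/

/-- **The uniformization in the Hodge model** `A`: `w ↦ (X^an ≃ₜ X(ℂ))⁻¹ (unif (T (w₀, w₁, 1)))`,
a total function on `ℂ²` agreeing with `ballUnifMap` on the ball.
[cite: BergeronMillsonMoeglin2016Balls, Introduction §1.1] [cite: SerreGAGA1956, §2] -/
def modelUnif (w : Fin 2 → ℂ) : A.carrier :=
  A.isAnalytification.homeomorph.symm (D.unif (𝔣.t *ᵥ ![w 0, w 1, 1]))

/-- On the ball, `modelUnif` is `ballUnifMap` read in `X^an`. [folklore] -/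
theorem modelUnif_coe (z : Ball) :
    D.modelUnif A 𝔣 z.1 = A.isAnalytification.homeomorph.symm (D.ballUnifMap 𝔣 z) :=
  rfl

/-- `modelUnif` lies over `ballUnifMap`. [folklore] -/
theorem toComplexPoints_modelUnif (z : Ball) :
    A.toComplexPoints (D.modelUnif A 𝔣 z.1) = D.ballUnifMap 𝔣 z := by
  rw [modelUnif_coe]
  exact A.isAnalytification.homeomorph.apply_symm_apply _

/-- `modelUnif` is `Γ`-invariant on the ball. [cite: BergeronMillsonMoeglin2016Balls, Introduction
§1.1] -/
theorem modelUnif_smul (γ : D.Γ) (z : Ball) :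
    D.modelUnif A 𝔣 (D.ballRep 𝔣 γ • z).1 = D.modelUnif A 𝔣 z.1 := by
  rw [modelUnif_coe, modelUnif_coe, ballUnifMap_smul]

/-- `modelUnif ∘ (γ ·) = modelUnif` at ball points, with the action written as the map `actVec`
of `ℂ²`. [folklore] -/
theorem modelUnif_actVec (γ : D.Γ) (z : Ball) :
    D.modelUnif A 𝔣 (actVec (D.ballRep 𝔣 γ) z.1) = D.modelUnif A 𝔣 z.1 := by
  rw [BallModel.actVec_eq]
  exact D.modelUnif_smul A 𝔣 γ z

/-- Near a ball point, `modelUnif ∘ (γ ·)` and `modelUnif` agree (the ball is open). [folklore] -/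
theorem modelUnif_comp_actVec_eventuallyEq (γ : D.Γ) (z : Ball) :
    D.modelUnif A 𝔣 =ᶠ[𝓝 z.1] (D.modelUnif A 𝔣 ∘ actVec (D.ballRep 𝔣 γ)) := by
  filter_upwards [BallForms.isOpen_ballSet.mem_nhds (BallForms.coe_mem_ballSet z)] with w hw
  exact (D.modelUnif_actVec A 𝔣 γ ⟨w, hw⟩).symm

/-- `modelUnif` maps the ball onto `X^an`. [cite: BergeronMillsonMoeglin2016Balls, Introduction
§1.1] -/
theorem exists_modelUnif_eq (x : A.carrier) : ∃ z : Ball, D.modelUnif A 𝔣 z.1 = x := by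
  obtain ⟨z, hz⟩ := D.ballUnifMap_surjective 𝔣 (A.toComplexPoints x)
  refine ⟨z, ?_⟩
  rw [modelUnif_coe, hz]
  exact A.isAnalytification.homeomorph.symm_apply_apply x

/-- **Fibres**: two ball points have the same image in `X^an` iff they are `Γ`-conjugate.
[cite: BergeronMillsonMoeglin2016Balls, Introduction §1.1] -/
theorem modelUnif_eq_iff (z z' : Ball) :
    D.modelUnif A 𝔣 z.1 = D.modelUnif A 𝔣 z'.1 ↔ ∃ γ : D.Γ, D.ballRep 𝔣 γ • z = z' := by
  rw [modelUnif_coe, modelUnif_coe, A.isAnalytification.homeomorph.symm.injective.eq_iff,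
    ballUnifMap_eq_iff]

/-- `modelUnif` is continuous on the ball. [folklore] -/
theorem continuousOn_modelUnif : ContinuousOn (D.modelUnif A 𝔣) BallForms.ballSet :=
  continuousOn_iff_continuous_restrict.2
    (A.isAnalytification.homeomorph.symm.continuous.comp (D.continuous_ballUnifMap 𝔣))

/-- The affine section `w ↦ T (w₀, w₁, 1)` of the frame over `ℂ²` is complex-differentiable.
[folklore] -/
theorem differentiable_frameLift :
    Differentiable ℂ fun w : Fin 2 → ℂ ↦ 𝔣.t *ᵥ ![w 0, w 1, 1] := by
  have h1 : Differentiable ℂ fun w : Fin 2 → ℂ ↦ (![w 0, w 1, 1] : Fin 3 → ℂ) := by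
    refine differentiable_pi.2 fun i ↦ ?_
    fin_cases i
    · exact differentiable_apply (𝕜 := ℂ) (0 : Fin 2)
    · exact differentiable_apply (𝕜 := ℂ) (1 : Fin 2)
    · exact differentiable_const (1 : ℂ)
  exact (LinearMap.toContinuousLinearMap (Matrix.mulVecLin 𝔣.t)).differentiable.comp h1

/-- **(R0) The uniformization is holomorphic on the ball**, as a map into the complex manifold
`X^an` of the Hodge model — PROVED: regular functions pull back along `unif` to holomorphic
functions on the cone (`differentiableOn_unif`), hence along `modelUnif` to holomorphic functions
on the ball, and holomorphy into `X^an` is tested on regular functions (GAGA §2 n°6: local analytic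
coordinates of `X^h` are regular functions; the tree's
`IsAnalytification.mdifferentiableAt_of_comp_regular`).
[cite: SerreGAGA1956, §2 n°5 p. 9 and n°6 Prop. 3 Cor. 2] -/
theorem unifHolomorphic :
    MDifferentiableOn 𝓘(ℂ, Fin 2 → ℂ) 𝓘(ℂ, A.model) (D.modelUnif A 𝔣) BallForms.ballSet := by
  intro w hw
  suffices hd : MDifferentiableAt 𝓘(ℂ, Fin 2 → ℂ) 𝓘(ℂ, A.model) (D.modelUnif A 𝔣) w from
    hd.mdifferentiableWithinAt
  haveI := D.isSmoothProjective.smoothOfRelativeDimension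
  refine A.isAnalytification.mdifferentiableAt_of_comp_regular
    ((D.continuousOn_modelUnif A 𝔣).continuousAt (BallForms.isOpen_ballSet.mem_nhds hw)) ?_
  intro V hV hQ s
  have hψ : ∀ w' : Fin 2 → ℂ,
      A.toComplexPoints (D.modelUnif A 𝔣 w') = D.unif (𝔣.t *ᵥ ![w' 0, w' 1, 1]) :=
    fun w' ↦ A.isAnalytification.homeomorph.apply_symm_apply _
  have heq : (fun w' ↦ Motives.AlgPoints.evalOrZero V s (A.toComplexPoints (D.modelUnif A 𝔣 w'))) =
      (fun v ↦ Motives.AlgPoints.evalOrZero V s (D.unif v)) ∘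
        fun w' : Fin 2 → ℂ ↦ 𝔣.t *ᵥ ![w' 0, w' 1, 1] :=
    funext fun w' ↦ by simp only [Function.comp_apply, hψ]
  rw [heq, mdifferentiableAt_iff_differentiableAt]
  have hc : 𝔣.t *ᵥ ![w 0, w 1, 1] ∈ D.cone := (D.coneLift 𝔣 ⟨w, hw⟩).2
  have hO : IsOpen (D.cone ∩ D.unif ⁻¹' {P | P.pt ∈ V}) :=
    D.continuousOn_unif.isOpen_inter_preimage (isOpen_negCone _)
      (Motives.AlgPoints.isOpen_setOf_pt_mem V)
  have hmem : 𝔣.t *ᵥ ![w 0, w 1, 1] ∈ D.cone ∩ D.unif ⁻¹' {P | P.pt ∈ V} :=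
    ⟨hc, by show (D.unif _).pt ∈ V; rw [← hψ]; exact hQ⟩
  exact ((D.differentiableOn_unif ⟨V, hV⟩ s).differentiableAt (hO.mem_nhds hmem)).comp w
    (D.differentiable_frameLift 𝔣 w)

/-- `modelUnif` is complex-differentiable at every ball point. [cite: SerreGAGA1956, §2 n°5] -/
theorem mdifferentiableAt_modelUnif (z : Ball) :
    MDifferentiableAt 𝓘(ℂ, Fin 2 → ℂ) 𝓘(ℂ, A.model) (D.modelUnif A 𝔣) z.1 :=
  (D.unifHolomorphic A 𝔣).mdifferentiableAt
    (BallForms.isOpen_ballSet.mem_nhds (BallForms.coe_mem_ballSet z))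

/-! ### The differential of the uniformization and the chain rule for `ψ ∘ γ = ψ` -/

/-- The real differential `dψ_w : ℂ² →L[ℝ] A.model` of the uniformization (`T_w ℂ² = ℂ²`,
`T_x X^an = A.model`). [cite: VoisinHodgeI2002, §2.2.1] -/
def unifDeriv (w : Fin 2 → ℂ) : (Fin 2 → ℂ) →L[ℝ] A.model :=
  mfderiv 𝓘(ℝ, Fin 2 → ℂ) 𝓘(ℝ, A.model) (D.modelUnif A 𝔣) w

/-- The Jacobian matrix of `γ` at `z`, as a real continuous linear map of `ℂ²`. [folklore] -/
def jacCLM (g : U21) (z : Ball) : (Fin 2 → ℂ) →L[ℝ] (Fin 2 → ℂ) :=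
  (LinearMap.toContinuousLinearMap (Matrix.mulVecLin (Jac g z))).restrictScalars ℝ

/-- `jacCLM g z v = Jac g z *ᵥ v`. [folklore] -/
@[simp] theorem jacCLM_apply (g : U21) (z : Ball) (v : Fin 2 → ℂ) :
    jacCLM g z v = Jac g z *ᵥ v :=
  rfl

/-- The action map `actVec g` has real derivative `Jac g z` at `z`. [folklore] -/
theorem hasMFDerivAt_actVec (g : U21) (z : Ball) :
    HasMFDerivAt 𝓘(ℝ, Fin 2 → ℂ) 𝓘(ℝ, Fin 2 → ℂ) (actVec g) z.1 (jacCLM g z) :=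
  hasMFDerivAt_iff_hasFDerivAt.2 ((BallModel.hasFDerivAt_actVec g z).restrictScalars ℝ)

/-- **Chain rule for `ψ ∘ γ = ψ`**: `dψ_z = dψ_{γ z} ∘ J(γ, z)`. [cite: VoisinHodgeI2002, §2.2.1] -/
theorem unifDeriv_eq_comp (γ : D.Γ) (z : Ball) :
    D.unifDeriv A 𝔣 z.1 =
      (D.unifDeriv A 𝔣 (D.ballRep 𝔣 γ • z).1).comp (jacCLM (D.ballRep 𝔣 γ) z) := by
  have hψ : HasMFDerivAt 𝓘(ℝ, Fin 2 → ℂ) 𝓘(ℝ, A.model) (D.modelUnif A 𝔣)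
      (actVec (D.ballRep 𝔣 γ) z.1) (D.unifDeriv A 𝔣 (D.ballRep 𝔣 γ • z).1) := by
    rw [BallModel.actVec_eq]
    exact (D.mdifferentiableAt_modelUnif A 𝔣 _).real_of_complex.hasMFDerivAt
  exact ((hψ.comp z.1 (hasMFDerivAt_actVec (D.ballRep 𝔣 γ) z)).congr_of_eventuallyEq
    (D.modelUnif_comp_actVec_eventuallyEq A 𝔣 γ z)).mfderiv

/-- The real differential `dψ` is `ℂ`-linear (`ψ` is holomorphic).
[cite: VoisinHodgeI2002, §2.2.1] -/
theorem unifDeriv_smul (z : Ball) (c : ℂ) (v : Fin 2 → ℂ) :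
    D.unifDeriv A 𝔣 z.1 (c • v) = c • D.unifDeriv A 𝔣 z.1 v :=
  mfderiv_real_apply_smul (D.mdifferentiableAt_modelUnif A 𝔣 z) c v

/-- The `i`-th column of the Jacobian: `J *ᵥ eᵢ = J₀ᵢ e₀ + J₁ᵢ e₁`. [folklore] -/
theorem jac_mulVec_single (J : Matrix (Fin 2) (Fin 2) ℂ) (i : Fin 2) :
    J *ᵥ Pi.single i 1 = J 0 i • Pi.single 0 1 + J 1 i • Pi.single 1 1 := by
  ext j
  fin_cases i <;> fin_cases j <;> simp [Matrix.mulVec, dotProduct, Fin.sum_univ_two]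

/-! ### Pull-back of `1`-forms and `2`-forms to the ball -/

/-- **Pull-back of complex `1`-forms** on `X^an` to `ℂ²`-valued functions on the ball:
`α ↦ (z ↦ (α_{ψ z}(dψ_z e₀), α_{ψ z}(dψ_z e₁)))` — the coefficients of `ψ^* α` in `dz₀, dz₁` when
`α` has type `(1,0)`. [cite: VoisinHodgeI2002, §2.2.1] [cite: Borel1997, §5.14] -/
def formPullback₁ : MForm 𝓘(ℝ, A.model) A.carrier ℂ 1 →ₗ[ℂ] (Ball → (Fin 2 → ℂ)) where
  toFun α z i := α (D.modelUnif A 𝔣 z.1) fun _ ↦ D.unifDeriv A 𝔣 z.1 (Pi.single i 1)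
  map_add' _ _ := rfl
  map_smul' _ _ := rfl

/-- `formPullback₁ α z i = α_{ψ z} (dψ_z eᵢ)`. [folklore] -/
theorem formPullback₁_apply (α : MForm 𝓘(ℝ, A.model) A.carrier ℂ 1) (z : Ball) (i : Fin 2) :
    D.formPullback₁ A 𝔣 α z i =
      α (D.modelUnif A 𝔣 z.1) fun _ ↦ D.unifDeriv A 𝔣 z.1 (Pi.single i 1) :=
  rfl

/-- **Pull-back of complex `2`-forms** on `X^an` to functions on the ball:
`α ↦ (z ↦ α_{ψ z}(dψ_z e₀, dψ_z e₁))` — the coefficient of `ψ^* α` in `dz₀ ∧ dz₁` when `α` has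
type `(2,0)`. [cite: VoisinHodgeI2002, §2.2.1] [cite: Borel1997, §5.14] -/
def formPullback₂ : MForm 𝓘(ℝ, A.model) A.carrier ℂ 2 →ₗ[ℂ] (Ball → ℂ) where
  toFun α z := α (D.modelUnif A 𝔣 z.1) ![D.unifDeriv A 𝔣 z.1 (Pi.single 0 1),
    D.unifDeriv A 𝔣 z.1 (Pi.single 1 1)]
  map_add' _ _ := rfl
  map_smul' _ _ := rfl

/-- `formPullback₂ α z = α_{ψ z} (dψ_z e₀, dψ_z e₁)`. [folklore] -/
theorem formPullback₂_apply (α : MForm 𝓘(ℝ, A.model) A.carrier ℂ 2) (z : Ball) :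
    D.formPullback₂ A 𝔣 α z = α (D.modelUnif A 𝔣 z.1)
      ![D.unifDeriv A 𝔣 z.1 (Pi.single 0 1), D.unifDeriv A 𝔣 z.1 (Pi.single 1 1)] :=
  rfl

variable {D A 𝔣}

/-- **Automorphy of pulled-back `(1,0)`-forms**: `F(z) = J(γ, z)ᵀ F(γ z)` for `γ ∈ Γ`.
[cite: Borel1997, §5.14] -/
theorem formPullback₁_smul {α : MForm 𝓘(ℝ, A.model) A.carrier ℂ 1}
    (hα : IsComplexLinearForm α) (γ : D.Γ) (z : Ball) :
    D.formPullback₁ A 𝔣 α z =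
      (Jac (D.ballRep 𝔣 γ) z)ᵀ *ᵥ D.formPullback₁ A 𝔣 α (D.ballRep 𝔣 γ • z) := by
  funext i
  rw [formPullback₁_apply, D.unifDeriv_eq_comp A 𝔣 γ z, ← D.modelUnif_smul A 𝔣 γ z]
  simp only [ContinuousLinearMap.comp_apply, jacCLM_apply, jac_mulVec_single, map_add,
    unifDeriv_smul]
  rw [mform₁_apply_add, mform₁_apply_smul hα, mform₁_apply_smul hα]
  simp [Matrix.mulVec, dotProduct, Fin.sum_univ_two, formPullback₁_apply]

/-- **Automorphy of pulled-back `(2,0)`-forms**: `G(z) = det J(γ, z) · G(γ z)` for `γ ∈ Γ` (the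
canonical automorphy factor). [cite: Borel1997, §5.14] -/
theorem formPullback₂_smul {α : MForm 𝓘(ℝ, A.model) A.carrier ℂ 2}
    (hα : IsComplexLinearForm α) (γ : D.Γ) (z : Ball) :
    D.formPullback₂ A 𝔣 α z =
      (Jac (D.ballRep 𝔣 γ) z).det * D.formPullback₂ A 𝔣 α (D.ballRep 𝔣 γ • z) := by
  rw [formPullback₂_apply, D.unifDeriv_eq_comp A 𝔣 γ z, ← D.modelUnif_smul A 𝔣 γ z]
  simp only [ContinuousLinearMap.comp_apply, jacCLM_apply, jac_mulVec_single, map_add,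
    unifDeriv_smul]
  rw [mform₂_apply_lincomb hα, formPullback₂_apply, Matrix.det_fin_two]
  ring

/-- Pulled-back `(1,0)`-forms are automorphic forms of **cotangent type** for (the image in
`U(2,1)` of) any `Δ ≤ Γ`. [cite: Borel1997, §5.14] -/
theorem formPullback₁_mem_factorForms {α : MForm 𝓘(ℝ, A.model) A.carrier ℂ 1}
    (hα : IsComplexLinearForm α) (Δ : Subgroup D.Γ) :
    D.formPullback₁ A 𝔣 α ∈ factorForms (Δ.map (D.ballRep 𝔣)) BallForms.cotangentCocycle := by
  rintro _ ⟨γ, -, rfl⟩ z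
  rw [BallForms.cotangentCocycle_apply]
  exact formPullback₁_smul hα γ z

/-- Pulled-back `(2,0)`-forms are automorphic forms of **canonical type** (`k = 1`) for (the image
in `U(2,1)` of) any `Δ ≤ Γ`. [cite: Borel1997, §5.14] -/
theorem formPullback₂_mem_factorForms {α : MForm 𝓘(ℝ, A.model) A.carrier ℂ 2}
    (hα : IsComplexLinearForm α) (Δ : Subgroup D.Γ) :
    D.formPullback₂ A 𝔣 α ∈ factorForms (Δ.map (D.ballRep 𝔣)) (BallForms.canonicalCocycle ℂ 1) := by
  rintro _ ⟨γ, -, rfl⟩ z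
  rw [BallForms.canonicalCocycle_apply, pow_one, smul_eq_mul]
  exact formPullback₂_smul hα γ z

/-- Forms of type `(1,0)` pull back to cotangent-type automorphic forms (the type hypothesis in the
tree's weight language `IsOfType`). [cite: HuybrechtsCG2005, Prop. 1.2.8] -/
theorem formPullback₁_mem_factorForms_of_isOfType {α : MForm 𝓘(ℝ, A.model) A.carrier ℂ 1}
    (hα : IsOfType 1 0 α) (Δ : Subgroup D.Γ) :
    D.formPullback₁ A 𝔣 α ∈ factorForms (Δ.map (D.ballRep 𝔣)) BallForms.cotangentCocycle :=
  formPullback₁_mem_factorForms hα.isComplexLinearForm Δ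

/-- Forms of type `(2,0)` pull back to canonical-type automorphic forms.
[cite: HuybrechtsCG2005, Prop. 1.2.8] -/
theorem formPullback₂_mem_factorForms_of_isOfType {α : MForm 𝓘(ℝ, A.model) A.carrier ℂ 2}
    (hα : IsOfType 2 0 α) (Δ : Subgroup D.Γ) :
    D.formPullback₂ A 𝔣 α ∈ factorForms (Δ.map (D.ballRep 𝔣)) (BallForms.canonicalCocycle ℂ 1) :=
  formPullback₂_mem_factorForms hα.isComplexLinearForm Δ

end UnitaryBallUniformisationDatum

end Literature.AlgebraicGeometry.ShimuraVarieties

end
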